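import Summits.HodgeConjecture.HodgeConjecture.Theorems.F0P2oYCoinvariantsTorusScalarCM     -- ★ p835587 (β)-CM: the Schur input
import Summits.HodgeConjecture.HodgeConjecture.Theorems.F0P2oThetaJacquetTorusFrame        -- ★ p835613 (5a): frame inputs (F)(hgy)(hgb) for `N(ℓ)` and `d(α,1,ᾱ⁻¹)`
import Summits.HodgeConjecture.HodgeConjecture.Theorems.F0P2oDoubledSwapSiegel             -- ★ F0P3a-p03 (g8) (C3′): `exists_involution_forall_isSiegelDelta` (swap + Siegel memberships)
import Literature.NumberTheory.GelbartRogawski1991.LocalSplittingCMParabolicEigenfunctional -- ★ p835588: the CM-datum assembler (eigen-law ⇒ ker-level scalar)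
import Literature.NumberTheory.GelbartRogawski1991.LocalDoubledUnitaryDeltaTransport         -- ★ `map_transportSp_deltaDiag_deltaLagrangian` (`δ ℓ_Δ = ℓ_Y`)
import Literature.NumberTheory.GelbartRogawski1991.DoubledUnitaryGlobalSplittingData         -- ★ `deltaD` (the rational `δ` of the doubled space)
import Literature.NumberTheory.GelbartRogawski1991.LocalLeraySection                         -- ★ `existsImplementer_localSchrodinger`
import Literature.NumberTheory.GelbartRogawski1991.CMThetaTypeVocabulary                     -- ★ `chiLocalSplittingsCM`
import Literature.NumberTheory.Automorphic.Liu2021.SplitPlaceHeckeEigenvaluesAtLine          -- ★ `congrW_undoubledSplittings_cmFinLocalFamily_s` (`𝓢.s v = localSplittingCM`)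
import Literature.NumberTheory.Automorphic.LocalRingUnitModulusProduct                       -- ★ p835417: `‖u‖^{1/2} = Π_w √‖u_w‖`
import Literature.NumberTheory.Automorphic.TorusCharacterLocalComponents                     -- ★ `semilocalComponent_eq_prod`
import Literature.RepresentationTheory.HeisenbergGroup.LocalWeilProjective                   -- ★ `MpPsi.proj_surjective`
import HarnessLib

/-!
# Crux `H413`, programme P2, N3 road — (D3d) THE ASSEMBLER AT THE CM PACKAGE: the split-torus element `d(α, 1, ᾱ⁻¹)` of `U(Φ₃)(L⁺_v)` acts on the
# `N`-coinvariants of Liu's local Weil representation `ω_v` (package ★ `chiLocalSplittingsCM … (toHeckeCharacter μ) … ε`) by `μ_v(α) · ‖α‖^{1/2}`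
# — print's (3.2.2) «`ω_ψ(diag(α, 1, ᾱ⁻¹)) Φ(w) = γ(α) ‖α‖^{1/2} Φ(ᾱ w)`» read on `r_N(ω³) ≅ ℱ`, KER-LEVEL (§1, A-p12's `ω_v` term verbatim; §2, the packager's `𝓢.omegaLoc v` currency = ★ `F0P2oN3TorusWeightOfD3d`'s socket `hK` token for token)

Cell hodgecm-mathlib (D-0151), FLOOR 0, crux item H413 = stmt-HodgeConjecture-24833, programme P2; N3 road note v2
(`F0/P2/B-p18/g28/N3-ROAD.v2.B-p18g28.md` §2 «STATUS AT SEAT CLOSE»), brick (D3d) THE ASSEMBLER (lead B-p18 (g28) 20:44:20Z ∕ group-level reshape «=»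
20:54:22Z ∕ output currency «ker-level» 21:07:54Z; seat A-p16 (g24)).  THEOREMS ONLY (no `def`, no instance, no notation, no named fact, no `sorry`); never
imports a `Cruxes/…/Lines` module; kernel lane `--supports stmt-HodgeConjecture-24833 --as helper`.  HC_CM is proved only modulo the printed citations until
rung 0 closes; nothing printed is asserted here.

THE STATEMENT `sub_smul_mem_coinvariantsKer_torus_chiLocalSplittingsCM`.  Data: the binders of ★ A-p12 `F0P2oYCoinvariantsCM` ∕ ★ `xThetaGqsCM` (CM field `L`,
`e₁ : Fin 3 × Fin 1 ≃ Fin n′`, `dV` real non-zero, `ε` a unit, `v ∤ ∞` NON-SPLIT, a form congruence `(T, a, h)` reading `U(Φ₃)(L⁺_v)` in `U(diag dV)(L⁺_v)`),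
a conjugate-symplectic `μ` (`IsConjugateSymplectic L μ`), the CM package `𝓢 := chiLocalSplittingsCM L e₁ dV hdV hdV0 (toHeckeCharacter L μ) _ ε` and its
pulled-back Weil representation `ω_v := toRep ∘ 𝓢.s v ∘ (localLineInl ∘ localPiEquiv⁻¹ ∘ cmDatumLocalCongr T)` on `𝒮(L⁺_v^{n′})` (A-p12's term verbatim);
the swap∕Siegel memberships are ★ F0P3a-p03 (g8)'s (C3′) `F0P2oDoubledSwapSiegel.exists_involution_forall_isSiegelDelta` (for every hyperbolic pair
`(y, ys)` of the pair form an involution `w₀` of the doubled group such that every `g ∈ U(diag dV ⊗ (ε))(L⁺_v)` scaling `y` by `α` and shearing `y^⊥`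
along `y` has `w₀ (g ⊕ 1) w₀ ∈ P_Δ` with `det_Δ = α`), used BY NAME — NO socket, NO named fact.
Conclusion: for every torus element `t` of the Borel of `U(Φ₃)(L⁺_v)` with middle entry `1` (`torusEntry … 1 t = 1`, i.e. `t = d(α, 1, ᾱ⁻¹)`,
`α = torusEntry … 0 t`) and every `f`,
**`ω_v(t) f − (μ_v(α) · ‖α‖^{1/2}) • f ∈ Coinvariants.ker (ω_v|_N)`**, `N = (cmBorelTriple L 3 v).N`, `μ_v = (toHeckeCharacter L μ).semilocalComponent L v`,
`‖·‖^{1/2} = halfModulusChar (LocalRing L v)` — the two factor-tokens of ★ `cmXiTorusChar`∕`xiTorusChar_apply` at coordinate `i = 0`.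

THE PROOF (every input ★): (5a) ★ p835613 `exists_frame_swapSiegel_inputs_of_nonsplit` gives the frame `(y, ys)` and the `(hgy)(hgb)` facts for
`N(ℓ)` (`α = 1`) and for `t` (`α = torusEntry 0 t`); ★ (C3′) gives `w₀`, the Siegel memberships and `det_Δ`; ★ `map_transportSp_deltaDiag_deltaLagrangian`
+ ★ `existsImplementer_localSchrodinger` + ★ `MpPsi.proj_surjective` give a mover `m₀` of `ℓ_Δ` onto `ℓ_Y`; ★ `congrW_undoubledSplittings_cmFinLocalFamily_s`
identifies `𝓢.s v` with `localSplittingCM = localSplittingCMWith … addHaar = undoubleLoc` of Kudla's doubled CM datum; ★ p835587 is the Schur input; ★ p835588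
`sub_smul_mem_coinvariantsKer_of_isSiegelDelta_conj` yields the ker-level membership with the scalar `(chiDet χ⁻¹ p)⁻¹ · Π_w √‖det_Δ p_w‖`,
`p = w₀ (t ⊕ 1) w₀`; finally `det_Δ p_w = α_w` + ★ `semilocalComponent_eq_prod` + ★ p835417 `coe_halfModulusChar_localRing_eq_prod` rewrite it as
`μ_v(α) · ‖α‖^{1/2}`.  [GelbartRogawski1991, §3.2 (3.2.2) p. 457; Kudla1994, §3 Thm. 3.1; HarrisKudlaSweet1996, §1 (1.15)–(1.16); Kudla1986, Thm. 2.8;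
MoeglinVignerasWaldspurger1987, Chap. 3 §IV.5.]

## References
* [GelbartRogawski1991] S. Gelbart, J. Rogawski, Invent. Math. 105 (1991): §3.1 Prop. 3.1.1 p. 455; §3.2 (3.2.1)–(3.2.3) p. 457.
* [Kudla1994] S. Kudla, Israel J. Math. 87 (1994), §3 Thm. 3.1.
* [HarrisKudlaSweet1996] M. Harris, S. Kudla, W. Sweet, J. AMS 9 (1996), §1 (1.11)–(1.16).
* [Kudla1986] S. Kudla, Invent. Math. 83 (1986): Thm. 2.8.
* [MoeglinVignerasWaldspurger1987] LNM 1291 (1987): Chap. 3 §IV.5.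
-/

set_option autoImplicit false
set_option linter.dupNamespace false -- the mandated namespace repeats the single-problem summit's segment

noncomputable section

open scoped MatrixGroups Kronecker
open _root_.Matrix NumberField IsDedekindDomain MeasureTheory
open Literature.NumberTheory.Automorphic Literature.NumberTheory.Automorphic.UnitaryGroup
open Literature.NumberTheory.Automorphic.IdeleClassGroup
open Literature.NumberTheory.Automorphic.Liu2021 Literature.NumberTheory.Automorphic.Liu2021.Def411WeilCarriers
open Literature.NumberTheory.Automorphic.Liu2021.Def411WeilCarriersDoubling
open Literature.NumberTheory.GelbartRogawski1991 Literature.NumberTheory.GelbartRogawski1991.UnitaryDualPair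
open Literature.NumberTheory.GelbartRogawski1991.UnitaryDualPair.LocalSplitting
open Literature.NumberTheory.Weil1964
open Literature.RepresentationTheory.Liu2021
open Literature.NumberTheory.GaloisRepresentations
open Literature.RepresentationTheory Literature.RepresentationTheory.HeisenbergGroup Literature.RepresentationTheory.HeisenbergGroup.SymplecticMatrix
open Literature.RepresentationTheory.HarrisKudlaSweet1996
open Summit.HodgeConjecture.HodgeConjecture.Cruxes.H413.F0P2oYCoinvariantsTorusScalarCM
open Summit.HodgeConjecture.HodgeConjecture.Cruxes.H413.F0P2oThetaJacquetTorusFrame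
open Summit.HodgeConjecture.HodgeConjecture.Cruxes.H413.F0P2oDoubledSwapSiegel

namespace Summit.HodgeConjecture.HodgeConjecture.Cruxes.H413.F0P2oThetaJacquetTorusWeight

variable (L : Type) [Field L] [NumberField L] [IsCMField L]

/-! ## §1 The weight at A-p12's `ω_v` term -/

set_option synthInstance.maxHeartbeats 400000 in
set_option maxHeartbeats 16000000 in
/-- **(D3d) AT THE CM PACKAGE — `d(α, 1, ᾱ⁻¹)` ACTS ON `r_N(ω_v)` BY `μ_v(α) · ‖α‖^{1/2}`, KER-LEVEL** (A-p12's `ω_v` term verbatim; see the module docstring for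
every binder and the proof; `v` non-split). [cite: GelbartRogawski1991, §3.2 (3.2.2) p. 457] [cite: Kudla1994, §3 Thm. 3.1] [cite: HarrisKudlaSweet1996, §1 (1.16)]
[cite: Kudla1986, proof of Thm. 2.8] -/
theorem sub_smul_mem_coinvariantsKer_torus_chiLocalSplittingsCM {n' : ℕ} (e₁ : Fin 3 × Fin 1 ≃ Fin n') (dV : Fin 3 → L)
    (hdV : ∀ i, IsCMField.complexConj L (dV i) = dV i) (hdV0 : ∀ i, dV i ≠ 0) (ε : (↥(maximalRealSubfield L))ˣ)
    (v : HeightOneSpectrum (𝓞 ↥(maximalRealSubfield L))) (hv : ∀ w : PlacesOver L v, IsCMField.complexConj L • w.1 = w.1)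
    (μ : Literature.NumberTheory.Automorphic.IdeleClassGroup L →ₜ* Circle) (hμ : IsConjugateSymplectic L μ)
    (T : GL (Fin 3) (UnitaryGroup.LocalRing L v)) {a : UnitaryGroup.LocalRing L v} (ha : IsUnit a)
    (h : formCongr (conjLocal L (IsCMField.complexConj L) v) T ((Matrix.diagonal dV).map (algebraMap L (UnitaryGroup.LocalRing L v))) =
      a • (Matrix.of fun i j : Fin 3 => if i.val + j.val + 1 = 3 then (1 : L) else 0).map (algebraMap L (UnitaryGroup.LocalRing L v)))
    (t : ↥((cmBorelTriple L 3 v).M))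
    (ht1 : torusEntry (conjLocal L (IsCMField.complexConj L) v) (cmLocalForm L 3 v) 1 t = 1)
    (f : SchwartzBruhat (Fin n' → v.adicCompletion ↥(maximalRealSubfield L))) :
    (((MpPsi.toRep (localSchrodinger (↥(maximalRealSubfield L)) n'
          (gram (↥(maximalRealSubfield L)) e₁ (realDiagonal L dV hdV) (TW (↥(maximalRealSubfield L)) ε)) v)).comp
        ((chiLocalSplittingsCM L e₁ dV hdV hdV0 (toHeckeCharacter L μ) ((isOscillatorChar_toHeckeCharacter_iff μ).mpr hμ) ε).s v)).comp
        ((localLineInl L (IsCMField.complexConj L) 3 e₁ (Matrix.diagonal dV) (JW (↥(maximalRealSubfield L)) L ε) v).comp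
          ((localPiEquiv L (IsCMField.complexConj L) 3 (Matrix.diagonal dV) v).symm.toMonoidHom.comp
            (cmDatumLocalCongr L v T ha h).toMonoidHom)))
        (t : ↥(unitaryGroupOfForm (conjLocal L (IsCMField.complexConj L) v) (cmLocalForm L 3 v))) f -
        ((((toHeckeCharacter L μ).semilocalComponent L v (torusEntry (conjLocal L (IsCMField.complexConj L) v) (cmLocalForm L 3 v) 0 t) *
            halfModulusChar (UnitaryGroup.LocalRing L v) (torusEntry (conjLocal L (IsCMField.complexConj L) v) (cmLocalForm L 3 v) 0 t) : ℂˣ) : ℂ)) • f ∈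
      Representation.Coinvariants.ker
        ((((MpPsi.toRep (localSchrodinger (↥(maximalRealSubfield L)) n'
          (gram (↥(maximalRealSubfield L)) e₁ (realDiagonal L dV hdV) (TW (↥(maximalRealSubfield L)) ε)) v)).comp
        ((chiLocalSplittingsCM L e₁ dV hdV hdV0 (toHeckeCharacter L μ) ((isOscillatorChar_toHeckeCharacter_iff μ).mpr hμ) ε).s v)).comp
        ((localLineInl L (IsCMField.complexConj L) 3 e₁ (Matrix.diagonal dV) (JW (↥(maximalRealSubfield L)) L ε) v).comp
          ((localPiEquiv L (IsCMField.complexConj L) 3 (Matrix.diagonal dV) v).symm.toMonoidHom.comp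
            (cmDatumLocalCongr L v T ha h).toMonoidHom))).comp (cmBorelTriple L 3 v).N.subtype) := by
  classical
  -- (0) the measure instances of record and the identification `𝓢.s v = localSplittingCM = localSplittingCMWith … addHaar`
  letI : MeasurableSpace (v.adicCompletion ↥(maximalRealSubfield L)) := borel _
  haveI : BorelSpace (v.adicCompletion ↥(maximalRealSubfield L)) := ⟨rfl⟩
  have hT₀d : IsUnit (gram (↥(maximalRealSubfield L)) e₁ (realDiagonal L dV hdV) (TW (↥(maximalRealSubfield L)) ε)).det :=
    isUnit_det_gram (↥(maximalRealSubfield L)) e₁ (isUnit_det_realDiagonal L dV hdV hdV0) (isUnit_det_TW (↥(maximalRealSubfield L)) ε)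
  have hsv : (chiLocalSplittingsCM L e₁ dV hdV hdV0 (toHeckeCharacter L μ) ((isOscillatorChar_toHeckeCharacter_iff μ).mpr hμ) ε).s v =
      localSplittingCMWith L n' (isSymm_gram (↥(maximalRealSubfield L)) e₁ (realDiagonal_isSymm L dV hdV) (isSymm_TW (↥(maximalRealSubfield L)) ε)) hT₀d
        (reindex_kronecker_eq_gram_map (↥(maximalRealSubfield L)) L e₁ (realDiagonal_map L dV hdV).symm (JW_eq (↥(maximalRealSubfield L)) L ε))
        (toHeckeCharacter L μ) ((isOscillatorChar_toHeckeCharacter_iff μ).mpr hμ) v Measure.addHaar :=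
    GRConstruction.congrW_undoubledSplittings_cmFinLocalFamily_s L e₁ dV hdV hdV0 (lineW L (TW (↥(maximalRealSubfield L)) ε))
      (complexConj_lineW L (TW (↥(maximalRealSubfield L)) ε)) (lineW_ne_zero L (TW (↥(maximalRealSubfield L)) ε) (isUnit_det_TW (↥(maximalRealSubfield L)) ε))
      (realDiagonal_lineW L (TW (↥(maximalRealSubfield L)) ε)) (diagonal_lineW L (TW (↥(maximalRealSubfield L)) ε) (JW_eq (↥(maximalRealSubfield L)) L ε))
      (isSymm_TW (↥(maximalRealSubfield L)) ε) (isUnit_det_TW (↥(maximalRealSubfield L)) ε) (JW_eq (↥(maximalRealSubfield L)) L ε)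
      (toHeckeCharacter L μ) ((isOscillatorChar_toHeckeCharacter_iff μ).mpr hμ) v
  rw [hsv]
  -- (1) the frame and its `(hgy)(hgb)` facts ★ p835613; (2) the swap involution `w₀` and the Siegel memberships ★ `F0P2oDoubledSwapSiegel`
  obtain ⟨y, ys, hyy, hsy, hys, hN', hT'⟩ := exists_frame_swapSiegel_inputs_of_nonsplit L e₁ dV hdV hdV0 ε v hv T ha h
  obtain ⟨w₀, hw₀, hS⟩ := exists_involution_forall_isSiegelDelta (↥(maximalRealSubfield L)) L (IsCMField.complexConj L) v n'
    (reindex_kronecker_eq_gram_map (↥(maximalRealSubfield L)) L e₁ (realDiagonal_map L dV hdV).symm (JW_eq (↥(maximalRealSubfield L)) L ε)) rfl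
    (complexConj_imagUnit L) (imagUnit_ne_zero L) (imagUnit_mul_self L)
    (isSymm_gram (↥(maximalRealSubfield L)) e₁ (realDiagonal_isSymm L dV hdV) (isSymm_TW (↥(maximalRealSubfield L)) ε)) hyy hsy hys
  -- (3) the chain `ch`
  obtain ⟨ch, hch⟩ : ∃ ch : (cmDatum L 3 (Matrix.of fun i j : Fin 3 => if i.val + j.val + 1 = 3 then (1 : L) else 0)).Local v →*
      localPi L (IsCMField.complexConj L) n' (Matrix.reindex e₁ e₁ (Matrix.diagonal dV ⊗ₖ JW (↥(maximalRealSubfield L)) L ε)) v,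
      ch = (localLineInl L (IsCMField.complexConj L) 3 e₁ (Matrix.diagonal dV) (JW (↥(maximalRealSubfield L)) L ε) v).comp
          ((localPiEquiv L (IsCMField.complexConj L) 3 (Matrix.diagonal dV) v).symm.toMonoidHom.comp
            (cmDatumLocalCongr L v T ha h).toMonoidHom) := ⟨_, rfl⟩
  have hchap : ∀ g, ch g = localLineInl L (IsCMField.complexConj L) 3 e₁ (Matrix.diagonal dV) (JW (↥(maximalRealSubfield L)) L ε) v
      ((localPiEquiv L (IsCMField.complexConj L) 3 (Matrix.diagonal dV) v).symm (cmDatumLocalCongr L v T ha h g)) := fun g => by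
    rw [hch]; rfl
  -- (4) the Siegel memberships for `N(ℓ)` (scalar `1`, `det_Δ = 1`) and for `t` (`det_Δ = α`)
  have hN : ∀ nn ∈ (cmBorelTriple L 3 v).N,
      IsSiegelDelta (↥(maximalRealSubfield L)) L (IsCMField.complexConj L) (complexConj_imagUnit L) (imagUnit_ne_zero L) (imagUnit_mul_self L) v n'
          (isSymm_gram (↥(maximalRealSubfield L)) e₁ (realDiagonal_isSymm L dV hdV) (isSymm_TW (↥(maximalRealSubfield L)) ε)) rfl
          (w₀ * inlLoc (↥(maximalRealSubfield L)) L (IsCMField.complexConj L) v n'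
            (reindex_kronecker_eq_gram_map (↥(maximalRealSubfield L)) L e₁ (realDiagonal_map L dV hdV).symm (JW_eq (↥(maximalRealSubfield L)) L ε))
            rfl (ch nn) * w₀) ∧
        ∀ w' : PlacesOver L v, detDelta (↥(maximalRealSubfield L)) L (IsCMField.complexConj L) v n' w'
          (w₀ * inlLoc (↥(maximalRealSubfield L)) L (IsCMField.complexConj L) v n'
            (reindex_kronecker_eq_gram_map (↥(maximalRealSubfield L)) L e₁ (realDiagonal_map L dV hdV).symm (JW_eq (↥(maximalRealSubfield L)) L ε))
            rfl (ch nn) * w₀) = 1 := by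
    intro nn hnn
    obtain ⟨hgy, hgb⟩ := hN' nn hnn
    have hgy' := hgy
    rw [← hchap] at hgy'
    have hgb' : ∀ b : Fin n' → UnitaryGroup.LocalRing L v,
        hermForm (conjLocal L (IsCMField.complexConj L) v)
            ((localGram (↥(maximalRealSubfield L)) n' (gram (↥(maximalRealSubfield L)) e₁ (realDiagonal L dV hdV) (TW (↥(maximalRealSubfield L)) ε)) v).map
              (toLocalRing L v)) y b = 0 →
          ∃ s : UnitaryGroup.LocalRing L v,
            (((UnitaryGroup.localPiEquiv L (IsCMField.complexConj L) n' (Matrix.reindex e₁ e₁ (Matrix.diagonal dV ⊗ₖ JW (↥(maximalRealSubfield L)) L ε)) v (ch nn) :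
                ↥(UnitaryGroup.«local» L (IsCMField.complexConj L) n' (Matrix.reindex e₁ e₁ (Matrix.diagonal dV ⊗ₖ JW (↥(maximalRealSubfield L)) L ε)) v)) :
                GL (Fin n') (UnitaryGroup.LocalRing L v)) : Matrix (Fin n') (Fin n') (UnitaryGroup.LocalRing L v)) *ᵥ b = b + s • y := by
      intro b hb; rw [hchap]; exact hgb b hb
    obtain ⟨hsd, hdet⟩ := hS (ch nn) 1 hgy' hgb'
    exact ⟨hsd, fun w' => by rw [hdet w']; rfl⟩
  obtain ⟨hgyt, hgbt⟩ := hT' t ht1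
  have hgyt' := hgyt
  rw [← hchap] at hgyt'
  have hgbt' : ∀ b : Fin n' → UnitaryGroup.LocalRing L v,
      hermForm (conjLocal L (IsCMField.complexConj L) v)
          ((localGram (↥(maximalRealSubfield L)) n' (gram (↥(maximalRealSubfield L)) e₁ (realDiagonal L dV hdV) (TW (↥(maximalRealSubfield L)) ε)) v).map
            (toLocalRing L v)) y b = 0 →
        ∃ s : UnitaryGroup.LocalRing L v,
          (((UnitaryGroup.localPiEquiv L (IsCMField.complexConj L) n' (Matrix.reindex e₁ e₁ (Matrix.diagonal dV ⊗ₖ JW (↥(maximalRealSubfield L)) L ε)) v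
              (ch (t : ↥(unitaryGroupOfForm (conjLocal L (IsCMField.complexConj L) v) (cmLocalForm L 3 v)))) :
              ↥(UnitaryGroup.«local» L (IsCMField.complexConj L) n' (Matrix.reindex e₁ e₁ (Matrix.diagonal dV ⊗ₖ JW (↥(maximalRealSubfield L)) L ε)) v)) :
              GL (Fin n') (UnitaryGroup.LocalRing L v)) : Matrix (Fin n') (Fin n') (UnitaryGroup.LocalRing L v)) *ᵥ b = b + s • y := by
    intro b hb; rw [hchap]; exact hgbt b hb
  obtain ⟨ht, hdett⟩ := hS (ch (t : ↥(unitaryGroupOfForm (conjLocal L (IsCMField.complexConj L) v) (cmLocalForm L 3 v)))) _ hgyt' hgbt'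
  -- (5) a mover `m₀` of `ℓ_Δ` onto `ℓ_Y` (the rational `δ` of the doubled space, lifted to an implementer)
  have hTv : IsUnit (localGram (↥(maximalRealSubfield L)) (n' + n')
      (gramD (↥(maximalRealSubfield L)) n' (gram (↥(maximalRealSubfield L)) e₁ (realDiagonal L dV hdV) (TW (↥(maximalRealSubfield L)) ε))) v).det :=
    UnitaryGroup.isUnit_det_map (algebraMap (↥(maximalRealSubfield L)) (v.adicCompletion ↥(maximalRealSubfield L)))
      (isUnit_det_gramD (↥(maximalRealSubfield L)) n' hT₀d)
  have hδ₀ := map_transportSp_deltaDiag_deltaLagrangian (↥(maximalRealSubfield L)) v n'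
    (T₀ := gram (↥(maximalRealSubfield L)) e₁ (realDiagonal L dV hdV) (TW (↥(maximalRealSubfield L)) ε)) hT₀d hTv
    (SymplecticMatrix.mapHom (algebraMap (↥(maximalRealSubfield L)) (v.adicCompletion ↥(maximalRealSubfield L))) (GRConstruction.deltaD L))
    (by
      rw [SymplecticMatrix.coe_mapHom]
      change (Matrix.reindex _ _ (deltaDiagMatrix (↥(maximalRealSubfield L)) (Fin n'))).map _ = _
      rw [Matrix.reindex_apply, Matrix.reindex_apply, ← Matrix.submatrix_map, deltaDiagMatrix_map])
  obtain ⟨m₀, hm₀'⟩ := MpPsi.proj_surjective _ (existsImplementer_localSchrodinger (↥(maximalRealSubfield L)) (n' + n')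
    (gramD (↥(maximalRealSubfield L)) n' (gram (↥(maximalRealSubfield L)) e₁ (realDiagonal L dV hdV) (TW (↥(maximalRealSubfield L)) ε)))
    (isUnit_det_gramD (↥(maximalRealSubfield L)) n' hT₀d) v)
    (transportSp (localGram (↥(maximalRealSubfield L)) (n' + n')
      (gramD (↥(maximalRealSubfield L)) n' (gram (↥(maximalRealSubfield L)) e₁ (realDiagonal L dV hdV) (TW (↥(maximalRealSubfield L)) ε))) v) hTv
      (SymplecticMatrix.mapHom (algebraMap (↥(maximalRealSubfield L)) (v.adicCompletion ↥(maximalRealSubfield L))) (GRConstruction.deltaD L)))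
  have hm₀ : (deltaLagrangian (↥(maximalRealSubfield L)) v n').map (toLin (↥(maximalRealSubfield L)) v (MpPsi.proj _ m₀)) =
      lagrangianY (↥(maximalRealSubfield L)) (n' + n') v := by
    rw [hm₀']; exact hδ₀
  -- (6) the Schur input ★ p835587, read on `localSplittingCMWith … addHaar`
  have hSchur := exists_sub_smul_mem_coinvariantsKer_torus_of_nonsplit L e₁ dV hdV hdV0 ε v hv
    (chiLocalSplittingsCM L e₁ dV hdV hdV0 (toHeckeCharacter L μ) ((isOscillatorChar_toHeckeCharacter_iff μ).mpr hμ) ε) T ha h t ht1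
  rw [hsv] at hSchur
  obtain ⟨c₀, -, hc₀⟩ := hSchur
  -- (7) the CM-datum assembler ★ p835588
  have key := sub_smul_mem_coinvariantsKer_of_isSiegelDelta_conj L v Measure.addHaar n'
    (isSymm_gram (↥(maximalRealSubfield L)) e₁ (realDiagonal_isSymm L dV hdV) (isSymm_TW (↥(maximalRealSubfield L)) ε)) hT₀d
    (reindex_kronecker_eq_gram_map (↥(maximalRealSubfield L)) L e₁ (realDiagonal_map L dV hdV).symm (JW_eq (↥(maximalRealSubfield L)) L ε))
    (toHeckeCharacter L μ) ((isOscillatorChar_toHeckeCharacter_iff μ).mpr hμ) m₀ hm₀ w₀ hw₀ ch (cmBorelTriple L 3 v).N hN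
    (t : ↥(unitaryGroupOfForm (conjLocal L (IsCMField.complexConj L) v) (cmLocalForm L 3 v))) ht ⟨c₀, by rw [hch]; exact hc₀⟩ f
  -- (8) the scalar: `(chiDet χ⁻¹ p)⁻¹ · Π_w √‖det_Δ p_w‖ = μ_v(α) · ‖α‖^{1/2}`, `det_Δ p_w = α_w`
  have hchi : LocalSplitting.chiDet (↥(maximalRealSubfield L)) L (IsCMField.complexConj L) v n'
        (fun w' : PlacesOver L v => ((toHeckeCharacter L μ).localComponent w'.1)⁻¹)
        (w₀ * inlLoc (↥(maximalRealSubfield L)) L (IsCMField.complexConj L) v n'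
          (reindex_kronecker_eq_gram_map (↥(maximalRealSubfield L)) L e₁ (realDiagonal_map L dV hdV).symm (JW_eq (↥(maximalRealSubfield L)) L ε))
          rfl (ch (t : ↥(unitaryGroupOfForm (conjLocal L (IsCMField.complexConj L) v) (cmLocalForm L 3 v)))) * w₀) =
      ((toHeckeCharacter L μ).semilocalComponent L v
        (torusEntry (conjLocal L (IsCMField.complexConj L) v) (cmLocalForm L 3 v) 0 t))⁻¹ := by
    unfold LocalSplitting.chiDet
    rw [semilocalComponent_eq_prod, ← Finset.prod_inv_distrib]
    refine Finset.prod_congr rfl fun w' _ => ?_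
    have hu : IsUnit (detDelta (↥(maximalRealSubfield L)) L (IsCMField.complexConj L) v n' w'
        (w₀ * inlLoc (↥(maximalRealSubfield L)) L (IsCMField.complexConj L) v n'
          (reindex_kronecker_eq_gram_map (↥(maximalRealSubfield L)) L e₁ (realDiagonal_map L dV hdV).symm (JW_eq (↥(maximalRealSubfield L)) L ε))
          rfl (ch (t : ↥(unitaryGroupOfForm (conjLocal L (IsCMField.complexConj L) v) (cmLocalForm L 3 v)))) * w₀)) := by
      rw [hdett w']
      exact (MulEquiv.piUnits (torusEntry (conjLocal L (IsCMField.complexConj L) v) (cmLocalForm L 3 v) 0 t) w').isUnit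
    rw [dif_pos hu]
    have hunit : hu.unit = MulEquiv.piUnits (torusEntry (conjLocal L (IsCMField.complexConj L) v) (cmLocalForm L 3 v) 0 t) w' :=
      Units.ext (by rw [IsUnit.unit_spec, hdett w']; rfl)
    rw [hunit, MonoidHom.inv_apply]
  have hnorm : ((∏ w' : PlacesOver L v, Real.sqrt ‖detDelta (↥(maximalRealSubfield L)) L (IsCMField.complexConj L) v n' w'
        (w₀ * inlLoc (↥(maximalRealSubfield L)) L (IsCMField.complexConj L) v n'
          (reindex_kronecker_eq_gram_map (↥(maximalRealSubfield L)) L e₁ (realDiagonal_map L dV hdV).symm (JW_eq (↥(maximalRealSubfield L)) L ε))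
          rfl (ch (t : ↥(unitaryGroupOfForm (conjLocal L (IsCMField.complexConj L) v) (cmLocalForm L 3 v)))) * w₀)‖ : ℝ) : ℂ) =
      ((halfModulusChar (UnitaryGroup.LocalRing L v) (torusEntry (conjLocal L (IsCMField.complexConj L) v) (cmLocalForm L 3 v) 0 t) : ℂˣ) : ℂ) := by
    rw [coe_halfModulusChar_localRing_eq_prod]
    congr 1
    exact Finset.prod_congr rfl fun w' _ => by rw [hdett w']
  have hscal : ((((LocalSplitting.chiDet (↥(maximalRealSubfield L)) L (IsCMField.complexConj L) v n'
          (fun w' : PlacesOver L v => ((toHeckeCharacter L μ).localComponent w'.1)⁻¹)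
          (w₀ * inlLoc (↥(maximalRealSubfield L)) L (IsCMField.complexConj L) v n'
            (reindex_kronecker_eq_gram_map (↥(maximalRealSubfield L)) L e₁ (realDiagonal_map L dV hdV).symm (JW_eq (↥(maximalRealSubfield L)) L ε))
            rfl (ch (t : ↥(unitaryGroupOfForm (conjLocal L (IsCMField.complexConj L) v) (cmLocalForm L 3 v)))) * w₀))⁻¹ : ℂˣ) : ℂ) *
        ((∏ w' : PlacesOver L v, Real.sqrt ‖detDelta (↥(maximalRealSubfield L)) L (IsCMField.complexConj L) v n' w'
          (w₀ * inlLoc (↥(maximalRealSubfield L)) L (IsCMField.complexConj L) v n'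
            (reindex_kronecker_eq_gram_map (↥(maximalRealSubfield L)) L e₁ (realDiagonal_map L dV hdV).symm (JW_eq (↥(maximalRealSubfield L)) L ε))
            rfl (ch (t : ↥(unitaryGroupOfForm (conjLocal L (IsCMField.complexConj L) v) (cmLocalForm L 3 v)))) * w₀)‖ : ℝ) : ℂ)) =
      (((toHeckeCharacter L μ).semilocalComponent L v (torusEntry (conjLocal L (IsCMField.complexConj L) v) (cmLocalForm L 3 v) 0 t) *
          halfModulusChar (UnitaryGroup.LocalRing L v) (torusEntry (conjLocal L (IsCMField.complexConj L) v) (cmLocalForm L 3 v) 0 t) : ℂˣ) : ℂ) := by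
    rw [hchi, inv_inv, hnorm, Units.val_mul]
  rw [hscal, hch] at key
  exact key


/-! ## §2 The weight in the packager's currency `𝓢.omegaLoc v` (socket `hK` of ★ `F0P2oN3TorusWeightOfD3d`) -/

set_option synthInstance.maxHeartbeats 400000 in
set_option maxHeartbeats 16000000 in
/-- **(D3d) IN THE PACKAGER'S CURRENCY `𝓢.omegaLoc v`** — the body of ★ `F0P2oN3TorusWeightOfD3d.thetaType_nonsplit_jacquetModule_b_of_kerWeight`'s socket `hK`
token for token (`FinLocalSplittings.omegaLoc v = toRep ∘ 𝓢.s v`, definitionally), at a non-split `v`: for `t ∈ T(L⁺_v)` with `t₁₁ = 1` and every `f`,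
`ω_v(ch t) f − μ_v(t₀₀) ‖t₀₀‖^{1/2} · f ∈ Coinvariants.ker ((ω_v ∘ ch)|_N)`. [cite: GelbartRogawski1991, §3.2 (3.2.2) p. 457] [cite: Kudla1986, proof of Thm. 2.8] -/
theorem omegaLoc_sub_smul_mem_coinvariantsKer_torus_of_nonsplit {n' : ℕ} (e₁ : Fin 3 × Fin 1 ≃ Fin n') (dV : Fin 3 → L)
    (hdV : ∀ i, IsCMField.complexConj L (dV i) = dV i) (hdV0 : ∀ i, dV i ≠ 0)
    (μ : Literature.NumberTheory.Automorphic.IdeleClassGroup L →ₜ* Circle) (hμ : IsConjugateSymplectic L μ)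
    (v : HeightOneSpectrum (𝓞 ↥(maximalRealSubfield L))) (hv : ∀ w : PlacesOver L v, IsCMField.complexConj L • w.1 = w.1)
    (ε : (↥(maximalRealSubfield L))ˣ)
    (T : GL (Fin 3) (UnitaryGroup.LocalRing L v)) {a : UnitaryGroup.LocalRing L v} (ha : IsUnit a)
    (h : formCongr (conjLocal L (IsCMField.complexConj L) v) T ((Matrix.diagonal dV).map (algebraMap L (UnitaryGroup.LocalRing L v))) =
      a • (Matrix.of fun i j : Fin 3 => if i.val + j.val + 1 = 3 then (1 : L) else 0).map (algebraMap L (UnitaryGroup.LocalRing L v)))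
    (t : ↥(cmBorelTriple L 3 v).M)
    (ht1 : torusEntry (conjLocal L (IsCMField.complexConj L) v) (cmLocalForm L 3 v) 1 t = 1)
    (f : SchwartzBruhat (Fin n' → v.adicCompletion ↥(maximalRealSubfield L))) :
    (chiLocalSplittingsCM L e₁ dV hdV hdV0 (toHeckeCharacter L μ) ((isOscillatorChar_toHeckeCharacter_iff μ).mpr hμ) ε).omegaLoc v
        (((localLineInl L (IsCMField.complexConj L) 3 e₁ (Matrix.diagonal dV) (JW (↥(maximalRealSubfield L)) L ε) v).comp
          ((localPiEquiv L (IsCMField.complexConj L) 3 (Matrix.diagonal dV) v).symm.toMonoidHom.comp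
            (cmDatumLocalCongr L v T ha h).toMonoidHom)) (t : ↥(unitaryGroupOfForm (conjLocal L (IsCMField.complexConj L) v) (cmLocalForm L 3 v)))) f -
      (((toHeckeCharacter L μ).semilocalComponent L v (torusEntry (conjLocal L (IsCMField.complexConj L) v) (cmLocalForm L 3 v) 0 t) *
          halfModulusChar (UnitaryGroup.LocalRing L v) (torusEntry (conjLocal L (IsCMField.complexConj L) v) (cmLocalForm L 3 v) 0 t) : ℂˣ) : ℂ) • f ∈
    Representation.Coinvariants.ker
      ((((chiLocalSplittingsCM L e₁ dV hdV hdV0 (toHeckeCharacter L μ) ((isOscillatorChar_toHeckeCharacter_iff μ).mpr hμ) ε).omegaLoc v).comp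
        ((localLineInl L (IsCMField.complexConj L) 3 e₁ (Matrix.diagonal dV) (JW (↥(maximalRealSubfield L)) L ε) v).comp
          ((localPiEquiv L (IsCMField.complexConj L) 3 (Matrix.diagonal dV) v).symm.toMonoidHom.comp
            (cmDatumLocalCongr L v T ha h).toMonoidHom))).comp (cmBorelTriple L 3 v).N.subtype) :=
  sub_smul_mem_coinvariantsKer_torus_chiLocalSplittingsCM L e₁ dV hdV hdV0 ε v hv μ hμ T ha h t ht1 f

end Summit.HodgeConjecture.HodgeConjecture.Cruxes.H413.F0P2oThetaJacquetTorusWeight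

end
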